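import Literature.AlgebraicGeometry.Deformation.SmoothSchemeLiftObstructionCriterionGlueReduction
import HarnessLib

/-!
# Gluing the lifted charts, VIII: the glued deformations form a CARTESIAN square over `Spec R' → Spec R`
# (Hartshorne, *Deformation Theory*, proof of Thm. 10.2 (a); `X'_{R'} = X'_R ×_{Spec R} Spec R'`)

HOME SEED (cell `hodgecm-mathlib`, F-11 (A3) F3b FILE 5; provisional path
`Deformation/SmoothSchemeLiftObstructionCriterionGluePullback.lean`).  Theorems only; imports FILE 4b.

For a `k`-algebra map `σ : R → R'` and compatible cocycle-exact lifted gluing data `ψ` over `R`, `ψ'` over `R'` (FILE 4b),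
the change-of-coefficients morphism `Φ : X'_{R'} ⟶ X'_R` of the glued deformations makes the square

  `X'_{R'} ─Φ→ X'_R`, `q' ↓       ↓ q`, `Spec R' ─Spec σ→ Spec R`

CARTESIAN.  Proof: a square is cartesian if it is so after restriction to the members of an open cover of the corner `X'_R`
(Mathlib `Scheme.isPullback_of_openCover`, for the chart cover of the glued scheme); over the chart
`Spec (R ⊗_k Γ(U j)) → X'_R` the chart square is cartesian (FILE 4b `isPullback_ι_baseChangeMap`), so the restricted
square is the affine square `Spec (R' ⊗_k Γ(U j)) → Spec (R ⊗_k Γ(U j))` over `Spec R' → Spec R`, which is `Spec` of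
the push-out `R' ⊗_R (R ⊗_k Γ(U j)) = R' ⊗_k Γ(U j)` (§1).

* §1 `isPushout_includeLeftRingHom_map` — the change-of-coefficients square of an affine chart is co-cartesian;
* §2 **`isPullback_baseChangeMap`** — the global square is cartesian;
* §3 `exists_baseChangeMap_isPullback` — packaged: a morphism `Φ` over `Spec σ`, chart-wise `Spec (σ ⊗ 1)`, with
  `X'_{R'} = X'_R ×_{Spec R} Spec R'`.

(For the reduction `A → A⧸J` of a small extension this is «`X'_A` restricts to `X'_{A⧸J}`»; with `R' = k`, `ψ' = 1` the
source is the re-glued closed fibre — sequel.)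
HC_CM is proved only modulo the 7 printed citations until rung 0 closes — nothing here bears on a summit statement.

## References
* [Hartshorne2010] R. Hartshorne, *Deformation Theory*, GTM 257, Springer (2010): Thm. 10.2 (a) and its proof (p. 81).
* [StacksProject] The Stacks Project, Tag 01JA (glueing schemes; functoriality), Tag 01LH (relative glueing),
  Tag 02XE (fibre products by glueing).
* [AtiyahMacdonald1969] M. F. Atiyah, I. G. Macdonald, *Introduction to Commutative Algebra* (1969): Ch. 2, tensor
  product of algebras (pp. 30–31), Ex. 2.15.
-/

noncomputable section

-- `TopCat.Presheaf`/`TopCat.Sheaf` are not reducible (as in Mathlib's `AlgebraicGeometry/Modules`).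
set_option backward.isDefEq.respectTransparency false

open CategoryTheory AlgebraicGeometry Opposite TopologicalSpace Limits
open scoped TensorProduct

universe u

namespace Literature.AlgebraicGeometry.Deformation

open Literature.AlgebraicGeometry.Motives Literature.AlgebraicGeometry.Morphisms

variable {k : Type u} [Field k] {X : Over (Spec (CommRingCat.of k))}
  [instΓ : ∀ W : X.left.Opens, Algebra k Γ(X.left, W)]
  (halg : ∀ (W : X.left.Opens) (s : k), algebraMap k Γ(X.left, W) s = (constToPresheaf X).app (op W) s)
  {R R' : Type u} [CommRing R] [Algebra k R] [CommRing R'] [Algebra k R'] (σ : R →ₐ[k] R')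
  {ι : Type u} (U : ι → X.left.affineOpens) (b : (j l : ι) → Γ(X.left, (U j).1))
  (hb : ∀ j l, (U j).1 ⊓ (U l).1 = X.left.basicOpen (b j l))
  (ψ : (j l : ι) → R ⊗[k] Γ(X.left, (U j).1 ⊓ (U l).1) ≃ₐ[R] R ⊗[k] Γ(X.left, (U j).1 ⊓ (U l).1))
  (ψ' : (j l : ι) → R' ⊗[k] Γ(X.left, (U j).1 ⊓ (U l).1) ≃ₐ[R'] R' ⊗[k] Γ(X.left, (U j).1 ⊓ (U l).1))
  (𝔫 : Ideal R) (h𝔫 : IsNilpotent 𝔫) (𝔫' : Ideal R') (h𝔫' : IsNilpotent 𝔫')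
  (hψ : ∀ j l x, ψ j l x - x ∈ 𝔫 • (⊤ : Submodule R (R ⊗[k] Γ(X.left, (U j).1 ⊓ (U l).1))))
  (hψ' : ∀ j l x, ψ' j l x - x ∈ 𝔫' • (⊤ : Submodule R' (R' ⊗[k] Γ(X.left, (U j).1 ⊓ (U l).1))))
  (hcoc : ∀ (j l m : ι)
    (Φjl : R ⊗[k] Γ(X.left, (U j).1 ⊓ (U l).1) →ₐ[R] R ⊗[k] Γ(X.left, (U j).1 ⊓ (U l).1 ⊓ (U m).1))
    (_ : ∀ a s, Φjl (a ⊗ₜ s) = a ⊗ₜ X.left.presheaf.map (homOfLE inf_le_left).op s)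
    (Φlm : R ⊗[k] Γ(X.left, (U l).1 ⊓ (U m).1) →ₐ[R] R ⊗[k] Γ(X.left, (U j).1 ⊓ (U l).1 ⊓ (U m).1))
    (_ : ∀ a s, Φlm (a ⊗ₜ s) = a ⊗ₜ X.left.presheaf.map
      (homOfLE (le_inf (inf_le_left.trans inf_le_right) inf_le_right)).op s)
    (Φjm : R ⊗[k] Γ(X.left, (U j).1 ⊓ (U m).1) →ₐ[R] R ⊗[k] Γ(X.left, (U j).1 ⊓ (U l).1 ⊓ (U m).1))
    (_ : ∀ a s, Φjm (a ⊗ₜ s) = a ⊗ₜ X.left.presheaf.map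
      (homOfLE (le_inf (inf_le_left.trans inf_le_left) inf_le_right)).op s)
    (ρjl ρlm ρjm : R ⊗[k] Γ(X.left, (U j).1 ⊓ (U l).1 ⊓ (U m).1) ≃ₐ[R]
      R ⊗[k] Γ(X.left, (U j).1 ⊓ (U l).1 ⊓ (U m).1)),
    (∀ x, ρjl (Φjl x) = Φjl (ψ j l x)) → (∀ x, ρlm (Φlm x) = Φlm (ψ l m x)) →
    (∀ x, ρjm (Φjm x) = Φjm (ψ j m x)) → ρlm * ρjl = ρjm)
  (hcoc' : ∀ (j l m : ι)
    (Φjl : R' ⊗[k] Γ(X.left, (U j).1 ⊓ (U l).1) →ₐ[R'] R' ⊗[k] Γ(X.left, (U j).1 ⊓ (U l).1 ⊓ (U m).1))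
    (_ : ∀ a s, Φjl (a ⊗ₜ s) = a ⊗ₜ X.left.presheaf.map (homOfLE inf_le_left).op s)
    (Φlm : R' ⊗[k] Γ(X.left, (U l).1 ⊓ (U m).1) →ₐ[R'] R' ⊗[k] Γ(X.left, (U j).1 ⊓ (U l).1 ⊓ (U m).1))
    (_ : ∀ a s, Φlm (a ⊗ₜ s) = a ⊗ₜ X.left.presheaf.map
      (homOfLE (le_inf (inf_le_left.trans inf_le_right) inf_le_right)).op s)
    (Φjm : R' ⊗[k] Γ(X.left, (U j).1 ⊓ (U m).1) →ₐ[R'] R' ⊗[k] Γ(X.left, (U j).1 ⊓ (U l).1 ⊓ (U m).1))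
    (_ : ∀ a s, Φjm (a ⊗ₜ s) = a ⊗ₜ X.left.presheaf.map
      (homOfLE (le_inf (inf_le_left.trans inf_le_left) inf_le_right)).op s)
    (ρjl ρlm ρjm : R' ⊗[k] Γ(X.left, (U j).1 ⊓ (U l).1 ⊓ (U m).1) ≃ₐ[R']
      R' ⊗[k] Γ(X.left, (U j).1 ⊓ (U l).1 ⊓ (U m).1)),
    (∀ x, ρjl (Φjl x) = Φjl (ψ' j l x)) → (∀ x, ρlm (Φlm x) = Φlm (ψ' l m x)) →
    (∀ x, ρjm (Φjm x) = Φjm (ψ' j m x)) → ρlm * ρjl = ρjm)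
  (hψσ : ∀ j l x, Algebra.TensorProduct.map σ (AlgHom.id k Γ(X.left, (U j).1 ⊓ (U l).1)) (ψ j l x) =
    ψ' j l (Algebra.TensorProduct.map σ (AlgHom.id k Γ(X.left, (U j).1 ⊓ (U l).1)) x))

/-! ## §1 The change-of-coefficients square of an affine chart is co-cartesian -/

/-- **The change-of-coefficients square of an affine chart is a push-out**: for `k`-algebras `σ : R → R'` and `B`,
`R' ⊗_R (R ⊗_k B) ≅ R' ⊗_k B`, i.e. the square `R → R ⊗_k B` (`r ↦ r ⊗ 1`), `σ`, `σ ⊗ 1`, `R' → R' ⊗_k B` is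
co-cartesian in commutative rings (Mathlib's push-out `R' ⊗_R (R ⊗_k B)` transported along `cancelBaseChange`).
[cite: AtiyahMacdonald1969, Ch. 2 (tensor product of algebras, pp. 30–31; Ex. 2.15)] -/
theorem isPushout_includeLeftRingHom_map (B : Type u) [CommRing B] [Algebra k B] :
    IsPushout (CommRingCat.ofHom (Algebra.TensorProduct.includeLeftRingHom (R := k) (A := R) (B := B)))
      (CommRingCat.ofHom σ.toRingHom)
      (CommRingCat.ofHom (Algebra.TensorProduct.map σ (AlgHom.id k B)).toRingHom)
      (CommRingCat.ofHom (Algebra.TensorProduct.includeLeftRingHom (R := k) (A := R') (B := B))) := by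
  letI : Algebra R R' := σ.toRingHom.toAlgebra
  haveI : IsScalarTower k R R' := IsScalarTower.of_algebraMap_eq fun c => (σ.commutes c).symm
  have h0 := (CommRingCat.isPushout_tensorProduct R R' (R ⊗[k] B)).flip
  have hf : algebraMap R (R ⊗[k] B) = Algebra.TensorProduct.includeLeftRingHom := by
    ext r
    simp [Algebra.TensorProduct.algebraMap_apply]
  have hg : algebraMap R R' = σ.toRingHom := RingHom.algebraMap_toAlgebra _
  rw [hf, hg] at h0
  refine h0.of_iso (Iso.refl _) (Iso.refl _) (Iso.refl _)
    (Algebra.TensorProduct.cancelBaseChange k R R' R' B).toRingEquiv.toCommRingCatIso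
    (by rw [Iso.refl_hom, Iso.refl_hom, Category.comp_id, Category.id_comp])
    (by rw [Iso.refl_hom, Iso.refl_hom, Category.comp_id, Category.id_comp]) ?_ ?_
  · rw [Iso.refl_hom, Category.id_comp]
    refine CommRingCat.hom_ext (RingHom.ext fun x => ?_)
    change (Algebra.TensorProduct.cancelBaseChange k R R' R' B) ((1 : R') ⊗ₜ[R] x) =
      Algebra.TensorProduct.map σ (AlgHom.id k B) x
    induction x using TensorProduct.induction_on with
    | zero => simp
    | tmul r b =>
        rw [Algebra.TensorProduct.cancelBaseChange_tmul, Algebra.TensorProduct.map_tmul, Algebra.smul_def, mul_one, hg]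
        rfl
    | add x y hx hy => rw [TensorProduct.tmul_add, map_add, hx, hy, map_add]
  · rw [Iso.refl_hom, Category.id_comp]
    refine CommRingCat.hom_ext (RingHom.ext fun rr => ?_)
    change (Algebra.TensorProduct.cancelBaseChange k R R' R' B) (rr ⊗ₜ[R] (1 : R ⊗[k] B)) = rr ⊗ₜ 1
    rw [Algebra.TensorProduct.one_def, Algebra.TensorProduct.cancelBaseChange_tmul, one_smul]

/-- `Spec` of §1: the affine chart square `Spec (R' ⊗_k B) → Spec (R ⊗_k B)` over `Spec R' → Spec R` is CARTESIAN.
[cite: StacksProject, Tag 01LH] [cite: AtiyahMacdonald1969, Ch. 2 (pp. 30–31; Ex. 2.15)] -/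
theorem isPullback_SpecMap_map_includeLeftRingHom (B : Type u) [CommRing B] [Algebra k B] :
    IsPullback (Spec.map (CommRingCat.ofHom (Algebra.TensorProduct.map σ (AlgHom.id k B)).toRingHom))
      (Spec.map (CommRingCat.ofHom (Algebra.TensorProduct.includeLeftRingHom (R := k) (A := R') (B := B))))
      (Spec.map (CommRingCat.ofHom (Algebra.TensorProduct.includeLeftRingHom (R := k) (A := R) (B := B))))
      (Spec.map (CommRingCat.ofHom σ.toRingHom)) :=
  isPullback_SpecMap_of_isPushout _ _ _ _ (isPushout_includeLeftRingHom_map σ B)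

/-! ## §2 The global square is cartesian -/

/-- **THE GLUED DEFORMATIONS FORM A CARTESIAN SQUARE**: for the change-of-coefficients morphism `Φ : X'_{R'} ⟶ X'_R`
(chart-wise `Spec (σ ⊗ 1)`, FILE 4b) and the structure maps `q`, `q'` (FILE 3), `X'_{R'} = X'_R ×_{Spec R} Spec R'`:
cartesian after restriction to every chart of `X'_R` (FILE 4b `isPullback_ι_baseChangeMap` + §1), hence cartesian
(Mathlib `Scheme.isPullback_of_openCover`). [cite: StacksProject, Tag 01LH; Tag 02XE] [cite: Hartshorne2010, Thm. 10.2 (proof), p. 81] -/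
theorem isPullback_baseChangeMap
    (Φ : (deformationGlueDatum halg R' U b hb ψ' 𝔫' h𝔫' hψ' hcoc').glueData.glued ⟶
      (deformationGlueDatum halg R U b hb ψ 𝔫 h𝔫 hψ hcoc).glueData.glued)
    (hΦ : ∀ j, (deformationGlueDatum halg R' U b hb ψ' 𝔫' h𝔫' hψ' hcoc').glueData.ι j ≫ Φ =
      Spec.map (CommRingCat.ofHom (Algebra.TensorProduct.map σ (AlgHom.id k Γ(X.left, (U j).1))).toRingHom) ≫
        (deformationGlueDatum halg R U b hb ψ 𝔫 h𝔫 hψ hcoc).glueData.ι j)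
    (q : (deformationGlueDatum halg R U b hb ψ 𝔫 h𝔫 hψ hcoc).glueData.glued ⟶ Spec (CommRingCat.of R))
    (hq : ∀ j, (deformationGlueDatum halg R U b hb ψ 𝔫 h𝔫 hψ hcoc).glueData.ι j ≫ q =
      Spec.map (CommRingCat.ofHom (Algebra.TensorProduct.includeLeftRingHom (R := k) (A := R) (B := Γ(X.left, (U j).1)))))
    (q' : (deformationGlueDatum halg R' U b hb ψ' 𝔫' h𝔫' hψ' hcoc').glueData.glued ⟶ Spec (CommRingCat.of R'))
    (hq' : ∀ j, (deformationGlueDatum halg R' U b hb ψ' 𝔫' h𝔫' hψ' hcoc').glueData.ι j ≫ q' =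
      Spec.map (CommRingCat.ofHom (Algebra.TensorProduct.includeLeftRingHom (R := k) (A := R') (B := Γ(X.left, (U j).1))))) :
    IsPullback Φ q' q (Spec.map (CommRingCat.ofHom σ.toRingHom)) := by
  refine Scheme.isPullback_of_openCover Φ q' q _ (deformationGlueDatum halg R U b hb ψ 𝔫 h𝔫 hψ hcoc).glueData.openCover
    fun j => ?_
  change IsPullback (pullback.snd Φ ((deformationGlueDatum halg R U b hb ψ 𝔫 h𝔫 hψ hcoc).glueData.ι j))
    (pullback.fst Φ ((deformationGlueDatum halg R U b hb ψ 𝔫 h𝔫 hψ hcoc).glueData.ι j) ≫ q')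
    ((deformationGlueDatum halg R U b hb ψ 𝔫 h𝔫 hψ hcoc).glueData.ι j ≫ q) _
  -- the chart square `j` is cartesian (FILE 4b) and the affine square under it is `Spec` of the push-out of §1
  have hP := isPullback_ι_baseChangeMap halg σ U b hb ψ ψ' 𝔫 h𝔫 𝔫' h𝔫' hψ hψ' hcoc hcoc' Φ hΦ j
  have hA : IsPullback (Spec.map (CommRingCat.ofHom (Algebra.TensorProduct.map σ (AlgHom.id k Γ(X.left, (U j).1))).toRingHom))
      ((deformationGlueDatum halg R' U b hb ψ' 𝔫' h𝔫' hψ' hcoc').glueData.ι j ≫ q')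
      ((deformationGlueDatum halg R U b hb ψ 𝔫 h𝔫 hψ hcoc).glueData.ι j ≫ q) (Spec.map (CommRingCat.ofHom σ.toRingHom)) := by
    rw [hq j, hq' j]
    exact isPullback_SpecMap_map_includeLeftRingHom σ Γ(X.left, (U j).1)
  exact hA.of_iso hP.isoPullback (Iso.refl _) (Iso.refl _) (Iso.refl _)
    (by rw [Iso.refl_hom, Category.comp_id, IsPullback.isoPullback_hom_snd])
    (by rw [Iso.refl_hom, Category.comp_id, IsPullback.isoPullback_hom_fst_assoc])
    (by rw [Iso.refl_hom, Iso.refl_hom, Category.comp_id, Category.id_comp])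
    (by rw [Iso.refl_hom, Iso.refl_hom, Category.comp_id, Category.id_comp])

/-! ## §3 Packaged -/

include hψσ in
/-- **PACKAGED CHANGE OF COEFFICIENTS**: given the structure maps `q : X'_R → Spec R`, `q' : X'_{R'} → Spec R'` (FILE 3),
there is a morphism `Φ : X'_{R'} ⟶ X'_R`, chart-wise `Spec (σ ⊗ 1)`, over `Spec σ`, with `X'_{R'} = X'_R ×_{Spec R} Spec R'`.
[cite: StacksProject, Tag 01LH; Tag 02XE] [cite: Hartshorne2010, Thm. 10.2 (proof), p. 81] -/
theorem exists_baseChangeMap_isPullback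
    (q : (deformationGlueDatum halg R U b hb ψ 𝔫 h𝔫 hψ hcoc).glueData.glued ⟶ Spec (CommRingCat.of R))
    (hq : ∀ j, (deformationGlueDatum halg R U b hb ψ 𝔫 h𝔫 hψ hcoc).glueData.ι j ≫ q =
      Spec.map (CommRingCat.ofHom (Algebra.TensorProduct.includeLeftRingHom (R := k) (A := R) (B := Γ(X.left, (U j).1)))))
    (q' : (deformationGlueDatum halg R' U b hb ψ' 𝔫' h𝔫' hψ' hcoc').glueData.glued ⟶ Spec (CommRingCat.of R'))
    (hq' : ∀ j, (deformationGlueDatum halg R' U b hb ψ' 𝔫' h𝔫' hψ' hcoc').glueData.ι j ≫ q' =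
      Spec.map (CommRingCat.ofHom (Algebra.TensorProduct.includeLeftRingHom (R := k) (A := R') (B := Γ(X.left, (U j).1))))) :
    ∃ Φ : (deformationGlueDatum halg R' U b hb ψ' 𝔫' h𝔫' hψ' hcoc').glueData.glued ⟶
        (deformationGlueDatum halg R U b hb ψ 𝔫 h𝔫 hψ hcoc).glueData.glued,
      (∀ j, (deformationGlueDatum halg R' U b hb ψ' 𝔫' h𝔫' hψ' hcoc').glueData.ι j ≫ Φ =
        Spec.map (CommRingCat.ofHom (Algebra.TensorProduct.map σ (AlgHom.id k Γ(X.left, (U j).1))).toRingHom) ≫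
          (deformationGlueDatum halg R U b hb ψ 𝔫 h𝔫 hψ hcoc).glueData.ι j) ∧
      Φ ≫ q = q' ≫ Spec.map (CommRingCat.ofHom σ.toRingHom) ∧
      IsPullback Φ q' q (Spec.map (CommRingCat.ofHom σ.toRingHom)) := by
  obtain ⟨Φ, hΦ, -⟩ := existsUnique_baseChangeMap halg σ U b hb ψ ψ' 𝔫 h𝔫 𝔫' h𝔫' hψ hψ' hcoc hcoc' hψσ
  exact ⟨Φ, hΦ, baseChangeMap_comp_structureMap halg σ U b hb ψ ψ' 𝔫 h𝔫 𝔫' h𝔫' hψ hψ' hcoc hcoc' hψσ Φ hΦ q hq q' hq',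
    isPullback_baseChangeMap halg σ U b hb ψ ψ' 𝔫 h𝔫 𝔫' h𝔫' hψ hψ' hcoc hcoc' Φ hΦ q hq q' hq'⟩

end Literature.AlgebraicGeometry.Deformation

end
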